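import Mathlib
import Summits.RiemannHypothesis.RiemannHypothesis.Theorems.SoloInformedVerifiedWindow
import Summits.RiemannHypothesis.RiemannHypothesis.Theorems.HandoffSplitKernel
import HarnessLib

/-!
# Flat split kernels (handoff prove-1, ATTEMPT-15 §4.2 / ATTEMPT-16 §2, «V-1b»)

`HandoffSplitKernel` proves the RH-free half of THEOREM V for an arbitrary split kernel `φ` with its
transparency `θ`, polar defect `p` and strip decay `(D, k)` as hypotheses; Solo's mollifier kernel
has `p = e^δ - 1`, `θ = δ²h²`, a class whose tariff floors at `≈ 4·10⁻⁹` (ATTEMPT-15 §4.1).  Here the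
FLAT KERNELS of ATTEMPT-15 §4.2 are built in Lean: for an even mollifier profile `ψ` of radius `δ`,
`κ = ∫ ψ(x) e^{x/2} dx` (`expHalfMass`) and
`flatKernel ψ m = Σ_{j<m} (-1)^j C(m, j+1) κ^{-2(j+1)} (ψc ⋆ ψ̃c)^{⋆(j+1)}` (`convPow` = convolution
powers), with transform `1 - (1 - κ⁻² ψ̂(s) conj ψ̂(1 - conj s))^m` (`weilMellin_flatKernel`), equal on
the critical line to the real number `1 - (1 - κ⁻²|ψ̂(1/2+it)|²)^m ∈ [0, 1]` and to `1` at `s = 0, 1`: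
`flatKernel_split_fields` (the six fields of `IsSplitKernel (flatKernel ψ m) (2mδ)`, stated field
by field so that this file does not wait for that module's build), `flatKernel_polar_defect`
(**`p = 0` exactly**), `one_sub_lineSymbol_flatKernel_le` (transparency of order `2m`:
`1 - Φ(t) ≤ (1 - e^{-δ}(1 - δ²h²/2)²)^m` for `|t| < |h|`, `δ²h² ≤ 2`), `exists_even_isMollifier`.  The
strip-decay constant `D` (derivative `L¹` norms of the profile) is evaluated by the certificate job
in ball arithmetic (HOME handoff/prove-1/ATTEMPT-16.md §3), not here.  Nothing in this file bears on
the truth of RH; no hypothesis on the zeros of `ζ` is used.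
-/

set_option linter.dupNamespace false

open scoped ContDiff ComplexConjugate Real Topology
open Complex MeasureTheory Set Filter Literature.NumberTheory.LFunctions
  Literature.Analysis.SpecialFunctions

namespace Summit.RiemannHypothesis.RiemannHypothesis.Theorems

/-- Convolution powers: `convPow f j = f^{⋆(j+1)}` (`convPow f 0 = f`). -/
noncomputable def convPow (f : ℝ → ℂ) : ℕ → ℝ → ℂ
  | 0 => f
  | j + 1 => weilConv (convPow f j) f

/-- `convPow f 0 = f`. -/
@[simp] theorem convPow_zero (f : ℝ → ℂ) : convPow f 0 = f := rfl

/-- `convPow f (j+1) = convPow f j ⋆ f`. -/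
theorem convPow_succ (f : ℝ → ℂ) (j : ℕ) : convPow f (j + 1) = weilConv (convPow f j) f := rfl

variable {f : ℝ → ℂ}

/-- Convolution powers of a test function are test functions. -/
theorem isWeilTest_convPow (hf : IsWeilTest f) (j : ℕ) : IsWeilTest (convPow f j) := by
  induction j with
  | zero => simpa using hf
  | succ j ih => rw [convPow_succ]; exact ih.weilConv hf

/-- If `supp f ⊆ [-r, r]` then `supp f^{⋆(j+1)} ⊆ [-(j+1) r, (j+1) r]`. -/
theorem tsupport_convPow_subset (hf : IsWeilTest f) {r : ℝ} (hr : tsupport f ⊆ Icc (-r) r)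
    (j : ℕ) : tsupport (convPow f j) ⊆ Icc (-((j + 1 : ℝ) * r)) ((j + 1 : ℝ) * r) := by
  induction j with
  | zero => simpa using hr
  | succ j ih =>
    rw [convPow_succ]
    refine (tsupport_weilConv_subset (isWeilTest_convPow hf j).2).trans ?_
    rintro x ⟨u, hu, v, hv, rfl⟩
    have hu' := ih hu
    have hv' := hr hv
    simp only [mem_Icc, Nat.cast_add, Nat.cast_one] at hu' hv' ⊢
    constructor <;> nlinarith [hu'.1, hu'.2, hv'.1, hv'.2]

/-- `(f^{⋆(j+1)})^(s) = f̂(s)^{j+1}`. -/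
theorem weilMellin_convPow (hf : IsWeilTest f) (j : ℕ) (s : ℂ) :
    weilMellin (convPow f j) s = weilMellin f s ^ (j + 1) := by
  induction j with
  | zero => simp
  | succ j ih =>
    rw [convPow_succ, weilMellin_weilConv_holds (isWeilTest_convPow hf j).1.continuous
      (isWeilTest_convPow hf j).2 hf.1.continuous hf.2, ih]; ring

/-- A finite linear combination of test functions is a test function. -/
theorem isWeilTest_finset_sum {ι : Type*} (s : Finset ι) {F : ι → ℝ → ℂ} (c : ι → ℂ)
    (hF : ∀ i ∈ s, IsWeilTest (F i)) : IsWeilTest fun x ↦ ∑ i ∈ s, c i * F i x := by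
  classical
  induction s using Finset.induction_on with
  | empty =>
    simp only [Finset.sum_empty]
    exact ⟨contDiff_const, HasCompactSupport.zero⟩
  | insert a s ha ih =>
    have h1 : IsWeilTest fun x ↦ c a * F a x := (hF a (Finset.mem_insert_self a s)).const_mul (c a)
    have h2 := ih fun i hi ↦ hF i (Finset.mem_insert_of_mem hi)
    have := h1.add h2
    simp only [Finset.sum_insert ha]
    exact this

/-- The transform of a finite linear combination of test functions. -/
theorem weilMellin_finset_sum {ι : Type*} (s : Finset ι) {F : ι → ℝ → ℂ} (c : ι → ℂ)
    (hF : ∀ i ∈ s, IsWeilTest (F i)) (z : ℂ) :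
    weilMellin (fun x ↦ ∑ i ∈ s, c i * F i x) z = ∑ i ∈ s, c i * weilMellin (F i) z := by
  unfold weilMellin
  have hint : ∀ i ∈ s, Integrable fun t : ℝ ↦ c i * (F i t * cexp ((z - 1 / 2) * t)) :=
    fun i hi ↦ (integrable_weilIntegrand (hF i hi).1.continuous (hF i hi).2 z).const_mul (c i)
  simp_rw [Finset.sum_mul]
  have e : (fun t : ℝ ↦ ∑ i ∈ s, c i * F i t * cexp ((z - 1 / 2) * t)) =
      fun t : ℝ ↦ ∑ i ∈ s, c i * (F i t * cexp ((z - 1 / 2) * t)) := by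
    funext t; refine Finset.sum_congr rfl fun i _ ↦ by ring
  rw [e, integral_finsetSum s hint]
  refine Finset.sum_congr rfl fun i _ ↦ ?_
  exact integral_const_mul _ _

/-- The support of a finite linear combination lies in any closed interval containing all the
supports. -/
theorem tsupport_finset_sum_subset {ι : Type*} (s : Finset ι) {F : ι → ℝ → ℂ} (c : ι → ℂ)
    {R : ℝ} (hF : ∀ i ∈ s, tsupport (F i) ⊆ Icc (-R) R) :
    tsupport (fun x ↦ ∑ i ∈ s, c i * F i x) ⊆ Icc (-R) R := by
  refine closure_minimal (fun x hx ↦ ?_) isClosed_Icc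
  by_contra hxR
  refine hx (Finset.sum_eq_zero fun i hi ↦ ?_)
  have : F i x = 0 := by_contra fun hne ↦ hxR (hF i hi (subset_tsupport _ hne))
  rw [this, mul_zero]

/-- `κ(ψ) = ∫ ψ(x) e^{x/2} dx` (`= ψ̂c(1) = ψ̂c(0)` for an even profile). -/
noncomputable def expHalfMass (ψ : ℝ → ℝ) : ℝ := ∫ x, ψ x * Real.exp (x / 2)

namespace IsMollifier

variable {ψ : ℝ → ℝ} {δ : ℝ}

/-- `ψ̂c(1) = κ`. -/
theorem weilMellin_one (_h : IsMollifier ψ δ) : weilMellin (mollC ψ) 1 = (expHalfMass ψ : ℂ) := by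
  unfold weilMellin expHalfMass mollC
  rw [← integral_complex_ofReal]
  congr 1 with x
  have : ((1 : ℂ) - 1 / 2) * (x : ℂ) = ((x / 2 : ℝ) : ℂ) := by push_cast; ring
  rw [this, ← Complex.ofReal_exp]; push_cast; ring

/-- For an even profile `ψ̂c(0) = κ`. -/
theorem weilMellin_zero_of_even (_h : IsMollifier ψ δ) (heven : ∀ x, ψ (-x) = ψ x) :
    weilMellin (mollC ψ) 0 = (expHalfMass ψ : ℂ) := by
  unfold weilMellin expHalfMass mollC
  rw [← integral_complex_ofReal]
  have hneg := integral_neg_eq_self (fun x : ℝ ↦ ((ψ x * Real.exp (x / 2) : ℝ) : ℂ)) volume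
  rw [← hneg]
  congr 1 with x
  have : ((0 : ℂ) - 1 / 2) * (x : ℂ) = (((-x) / 2 : ℝ) : ℂ) := by push_cast; ring
  rw [this, ← Complex.ofReal_exp, heven]; push_cast; ring

/-- `κ ≥ 1` (since `e^{x/2} + e^{-x/2} ≥ 2` and `ψ ≥ 0` has mass one; for even `ψ`). -/
theorem one_le_expHalfMass (h : IsMollifier ψ δ) (heven : ∀ x, ψ (-x) = ψ x) :
    1 ≤ expHalfMass ψ := by
  have hi1 : Integrable fun x ↦ ψ x * Real.exp (x / 2) :=
    (h.continuous.mul (by fun_prop)).integrable_of_hasCompactSupport h.hasCompactSupport.mul_right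
  have hi2 : Integrable fun x ↦ ψ x * Real.exp (-x / 2) :=
    (h.continuous.mul (by fun_prop)).integrable_of_hasCompactSupport h.hasCompactSupport.mul_right
  have hsym : ∫ x, ψ x * Real.exp (-x / 2) = expHalfMass ψ := by
    unfold expHalfMass
    rw [← integral_neg_eq_self (fun x : ℝ ↦ ψ x * Real.exp (x / 2)) volume]
    congr 1 with x; rw [heven]
  have hsum : expHalfMass ψ + expHalfMass ψ =
      ∫ x, (ψ x * Real.exp (x / 2) + ψ x * Real.exp (-x / 2)) := by
    nth_rw 2 [← hsym]; unfold expHalfMass; exact (integral_add hi1 hi2).symm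
  have hge : ∫ x, ψ x * 2 ≤ ∫ x, (ψ x * Real.exp (x / 2) + ψ x * Real.exp (-x / 2)) := by
    refine integral_mono (h.integrable.mul_const 2) (hi1.add hi2) fun x ↦ ?_
    have hab : Real.exp (x / 2) * Real.exp (-x / 2) = 1 := by
      rw [← Real.exp_add]; convert Real.exp_zero using 2; ring
    have h2 : 2 ≤ Real.exp (x / 2) + Real.exp (-x / 2) := by
      nlinarith [Real.exp_pos (x / 2), Real.exp_pos (-x / 2), hab,
        mul_self_nonneg (Real.exp (x / 2) - 1)]
    simpa only [mul_add] using mul_le_mul_of_nonneg_left h2 (h.nonneg x)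
  have hm : ∫ x, ψ x * 2 = 2 := by rw [integral_mul_const, h.mass]; ring
  linarith

/-- `κ ≤ e^{δ/2}` (support in `[-δ, δ]`, mass one). -/
theorem expHalfMass_le (h : IsMollifier ψ δ) : expHalfMass ψ ≤ Real.exp (δ / 2) := by
  unfold expHalfMass
  have hle : ∀ x, ψ x * Real.exp (x / 2) ≤ ψ x * Real.exp (δ / 2) := fun x ↦ by
    by_cases hx : |x| ≤ δ
    · refine mul_le_mul_of_nonneg_left (Real.exp_le_exp.2 ?_) (h.nonneg x)
      linarith [le_abs_self x]
    · rw [h.eq_zero_of_lt (not_le.1 hx)]; simp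
  calc ∫ x, ψ x * Real.exp (x / 2) ≤ ∫ x, ψ x * Real.exp (δ / 2) :=
        integral_mono ((h.continuous.mul (by fun_prop)).integrable_of_hasCompactSupport
          h.hasCompactSupport.mul_right) (h.integrable.mul_const _) hle
    _ = Real.exp (δ / 2) := by rw [integral_mul_const, h.mass, one_mul]

/-- `0 < κ`. -/
theorem expHalfMass_pos (h : IsMollifier ψ δ) (heven : ∀ x, ψ (-x) = ψ x) : 0 < expHalfMass ψ :=
  lt_of_lt_of_le one_pos (h.one_le_expHalfMass heven)

/-- The transform of `ψc ⋆ ψ̃c` everywhere: `ψ̂(s) · conj ψ̂(1 - conj s)`. -/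
theorem weilMellin_mollKernel (h : IsMollifier ψ δ) (s : ℂ) :
    weilMellin (mollKernel ψ) s =
      weilMellin (mollC ψ) s * conj (weilMellin (mollC ψ) (1 - conj s)) := by
  unfold mollKernel
  rw [weilMellin_weilConv_holds h.isWeilTest.1.continuous h.isWeilTest.2
    h.isWeilTest.weilReflect.1.continuous h.isWeilTest.weilReflect.2, weilMellin_weilReflect_holds]

/-- `(ψc ⋆ ψ̃c)^(0) = κ²` for an even profile. -/
theorem weilMellin_mollKernel_zero (h : IsMollifier ψ δ) (heven : ∀ x, ψ (-x) = ψ x) :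
    weilMellin (mollKernel ψ) 0 = (expHalfMass ψ : ℂ) ^ 2 := by
  rw [h.weilMellin_mollKernel, map_zero, sub_zero, h.weilMellin_one, h.weilMellin_zero_of_even heven,
    Complex.conj_ofReal, sq]

/-- `(ψc ⋆ ψ̃c)^(1) = κ²` for an even profile. -/
theorem weilMellin_mollKernel_one (h : IsMollifier ψ δ) (heven : ∀ x, ψ (-x) = ψ x) :
    weilMellin (mollKernel ψ) 1 = (expHalfMass ψ : ℂ) ^ 2 := by
  rw [h.weilMellin_mollKernel, map_one, sub_self, h.weilMellin_one, h.weilMellin_zero_of_even heven,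
    Complex.conj_ofReal, sq]

end IsMollifier

/-- The coefficient `(-1)^j C(m, j+1) κ^{-2(j+1)}` of the `(j+1)`-st convolution power. -/
noncomputable def flatCoeff (ψ : ℝ → ℝ) (m j : ℕ) : ℂ :=
  (-1) ^ j * (m.choose (j + 1) : ℂ) * ((expHalfMass ψ : ℂ) ^ 2)⁻¹ ^ (j + 1)

/-- The **flat kernel of order `m`** on the profile `ψ` (ATTEMPT-15 §4.2):
`φ = Σ_{j<m} (-1)^j C(m,j+1) κ^{-2(j+1)} (ψc ⋆ ψ̃c)^{⋆(j+1)}`, i.e. `φ̂ = 1 - (1 - κ⁻²(ψc ⋆ ψ̃c)^)^m`. -/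
noncomputable def flatKernel (ψ : ℝ → ℝ) (m : ℕ) : ℝ → ℂ :=
  fun x ↦ ∑ j ∈ Finset.range m, flatCoeff ψ m j * convPow (mollKernel ψ) j x

variable {ψ : ℝ → ℝ} {δ : ℝ}

/-- The flat kernel is a test function. -/
theorem isWeilTest_flatKernel (h : IsMollifier ψ δ) (m : ℕ) : IsWeilTest (flatKernel ψ m) :=
  isWeilTest_finset_sum _ _ fun j _ ↦ isWeilTest_convPow h.isWeilTest_mollKernel j

/-- The flat kernel of order `m` is supported in `[-2mδ, 2mδ]`. -/
theorem tsupport_flatKernel_subset (h : IsMollifier ψ δ) (m : ℕ) :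
    tsupport (flatKernel ψ m) ⊆ Icc (-(2 * m * δ)) (2 * m * δ) := by
  refine tsupport_finset_sum_subset _ _ fun j hj ↦ ?_
  have hj' : (j : ℝ) + 1 ≤ m := by exact_mod_cast Finset.mem_range.1 hj
  have hδ := h.radius_nonneg
  refine (tsupport_convPow_subset h.isWeilTest_mollKernel h.tsupport_mollKernel_subset j).trans
    (Icc_subset_Icc ?_ ?_) <;> nlinarith

/-- The binomial identity behind flatness: `Σ_{j<m} (-1)^j C(m,j+1) w^{j+1} = 1 - (1 - w)^m`. -/
theorem flat_binomial (w : ℂ) (m : ℕ) :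
    ∑ j ∈ Finset.range m, (-1) ^ j * (m.choose (j + 1) : ℂ) * w ^ (j + 1) = 1 - (1 - w) ^ m := by
  have hbin := add_pow (-w) 1 m
  simp only [one_pow, mul_one] at hbin
  rw [Finset.sum_range_succ'] at hbin
  simp only [pow_zero, Nat.choose_zero_right, Nat.cast_one, mul_one] at hbin
  have e : ∀ j ∈ Finset.range m, (-w) ^ (j + 1) * (m.choose (j + 1) : ℂ) =
      -((-1) ^ j * (m.choose (j + 1) : ℂ) * w ^ (j + 1)) := by
    intro j _
    rw [neg_pow w (j + 1), pow_succ (-1 : ℂ) j]; ring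
  rw [Finset.sum_congr rfl e, Finset.sum_neg_distrib] at hbin
  rw [sub_eq_neg_add 1 w, hbin]; ring

/-- **Transform of the flat kernel**: `φ̂(s) = 1 - (1 - κ⁻² ψ̂(s) conj ψ̂(1 - conj s))^m`. -/
theorem weilMellin_flatKernel (h : IsMollifier ψ δ) (m : ℕ) (s : ℂ) :
    weilMellin (flatKernel ψ m) s =
      1 - (1 - ((expHalfMass ψ : ℂ) ^ 2)⁻¹ *
        (weilMellin (mollC ψ) s * conj (weilMellin (mollC ψ) (1 - conj s)))) ^ m := by
  unfold flatKernel
  rw [weilMellin_finset_sum _ _ fun j _ ↦ isWeilTest_convPow h.isWeilTest_mollKernel j]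
  rw [← flat_binomial]
  refine Finset.sum_congr rfl fun j _ ↦ ?_
  rw [weilMellin_convPow h.isWeilTest_mollKernel, h.weilMellin_mollKernel, flatCoeff, mul_pow]
  ring

/-- The real line symbol `x(t) = κ⁻² |ψ̂c(1/2+it)|²` of `κ⁻² (ψc ⋆ ψ̃c)`. -/
noncomputable def flatBase (ψ : ℝ → ℝ) (t : ℝ) : ℝ :=
  (expHalfMass ψ ^ 2)⁻¹ * ‖weilMellin (mollC ψ) (1 / 2 + t * I)‖ ^ 2

/-- `0 ≤ x(t)`. -/
theorem flatBase_nonneg (ψ : ℝ → ℝ) (t : ℝ) : 0 ≤ flatBase ψ t := by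
  unfold flatBase; positivity

/-- `x(t) ≤ 1` (`|ψ̂c(1/2+it)| ≤ 1 ≤ κ`). -/
theorem flatBase_le_one (h : IsMollifier ψ δ) (heven : ∀ x, ψ (-x) = ψ x) (t : ℝ) :
    flatBase ψ t ≤ 1 := by
  unfold flatBase
  have hκ := h.one_le_expHalfMass heven
  have h1 := h.norm_weilMellin_half_line_le_one t
  have h0 := norm_nonneg (weilMellin (mollC ψ) (1 / 2 + t * I))
  have hκ2 : 1 ≤ expHalfMass ψ ^ 2 := by nlinarith
  rw [inv_mul_le_iff₀ (by positivity)]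
  nlinarith

/-- **On the critical line** `φ̂(1/2 + it) = 1 - (1 - x(t))^m`, a real number. -/
theorem weilMellin_flatKernel_half_line (h : IsMollifier ψ δ) (m : ℕ) (t : ℝ) :
    weilMellin (flatKernel ψ m) (1 / 2 + t * I) = ((1 - (1 - flatBase ψ t) ^ m : ℝ) : ℂ) := by
  rw [weilMellin_flatKernel h]
  have hs : (1 : ℂ) - conj (1 / 2 + (t : ℂ) * I) = 1 / 2 + t * I := by
    simp only [map_add, map_div₀, map_one, map_ofNat, map_mul, Complex.conj_ofReal, Complex.conj_I]
    ring
  rw [hs, Complex.mul_conj, Complex.normSq_eq_norm_sq, flatBase]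
  push_cast
  ring

/-- `φ̂(0) = 1` for `m ≥ 1` (polar defect `p = 0`). -/
theorem weilMellin_flatKernel_zero (h : IsMollifier ψ δ) (heven : ∀ x, ψ (-x) = ψ x) {m : ℕ}
    (hm : 1 ≤ m) : weilMellin (flatKernel ψ m) 0 = 1 := by
  rw [weilMellin_flatKernel h, map_zero, sub_zero, h.weilMellin_one, h.weilMellin_zero_of_even heven,
    Complex.conj_ofReal, ← sq, inv_mul_cancel₀ (pow_ne_zero _ (by
      exact_mod_cast (h.expHalfMass_pos heven).ne')), sub_self, zero_pow (by omega), sub_zero]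

/-- `φ̂(1) = 1` for `m ≥ 1` (polar defect `p = 0`). -/
theorem weilMellin_flatKernel_one (h : IsMollifier ψ δ) (heven : ∀ x, ψ (-x) = ψ x) {m : ℕ}
    (hm : 1 ≤ m) : weilMellin (flatKernel ψ m) 1 = 1 := by
  rw [weilMellin_flatKernel h, map_one, sub_self, h.weilMellin_one, h.weilMellin_zero_of_even heven,
    Complex.conj_ofReal, ← sq, inv_mul_cancel₀ (pow_ne_zero _ (by
      exact_mod_cast (h.expHalfMass_pos heven).ne')), sub_self, zero_pow (by omega), sub_zero]

/-- **The flat kernel has the split-kernel properties** (the six fields of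
`HandoffSplitKernel.IsSplitKernel (flatKernel ψ m) (2mδ)`, stated field by field so that this file
does not depend on that module): test function, support in `[-2mδ, 2mδ]`, `0 ≤ 2mδ`, and on the
critical line the transform is real with values in `[0, 1]`. -/
theorem flatKernel_split_fields (h : IsMollifier ψ δ) (heven : ∀ x, ψ (-x) = ψ x) (m : ℕ) :
    IsWeilTest (flatKernel ψ m) ∧ tsupport (flatKernel ψ m) ⊆ Icc (-(2 * m * δ)) (2 * m * δ) ∧
      0 ≤ 2 * (m : ℝ) * δ ∧
      (∀ t : ℝ, (weilMellin (flatKernel ψ m) (1 / 2 + t * I)).im = 0) ∧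
      (∀ t : ℝ, 0 ≤ (weilMellin (flatKernel ψ m) (1 / 2 + t * I)).re) ∧
      (∀ t : ℝ, (weilMellin (flatKernel ψ m) (1 / 2 + t * I)).re ≤ 1) := by
  refine ⟨isWeilTest_flatKernel h m, tsupport_flatKernel_subset h m,
    by have := h.radius_nonneg; positivity, fun t ↦ ?_, fun t ↦ ?_, fun t ↦ ?_⟩
  · rw [weilMellin_flatKernel_half_line h, Complex.ofReal_im]
  · rw [weilMellin_flatKernel_half_line h, Complex.ofReal_re, sub_nonneg]
    exact pow_le_one₀ (sub_nonneg.2 (flatBase_le_one h heven t))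
      (sub_le_self _ (flatBase_nonneg ψ t))
  · rw [weilMellin_flatKernel_half_line h, Complex.ofReal_re, sub_le_self_iff]
    exact pow_nonneg (sub_nonneg.2 (flatBase_le_one h heven t)) _

/-- The polar-defect hypotheses of THEOREM V hold with `p = 0`. -/
theorem flatKernel_polar_defect (h : IsMollifier ψ δ) (heven : ∀ x, ψ (-x) = ψ x) {m : ℕ}
    (hm : 1 ≤ m) :
    ‖1 - weilMellin (flatKernel ψ m) 0‖ ≤ 0 ∧ ‖1 - weilMellin (flatKernel ψ m) 1‖ ≤ 0 := by
  rw [weilMellin_flatKernel_zero h heven hm, weilMellin_flatKernel_one h heven hm, sub_self, norm_zero]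
  exact ⟨le_rfl, le_rfl⟩

/-- The line symbol of the flat kernel: `1 - Φ(t) = (1 - x(t))^m`, `Φ(t) = Re φ̂(1/2+it)`. -/
theorem one_sub_lineSymbol_flatKernel (h : IsMollifier ψ δ) (m : ℕ) (t : ℝ) :
    1 - (weilMellin (flatKernel ψ m) (1 / 2 + t * I)).re = (1 - flatBase ψ t) ^ m := by
  rw [weilMellin_flatKernel_half_line h, Complex.ofReal_re]; ring

/-- Lower bound for the base symbol near `t = 0`: `x(t) ≥ e^{-δ} (1 - δ²t²/2)²` when
`δ²t² ≤ 2` (from `Re ψ̂c(1/2+it) ≥ 1 - δ²t²/2` and `κ ≤ e^{δ/2}`). -/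
theorem flatBase_ge (h : IsMollifier ψ δ) (heven : ∀ x, ψ (-x) = ψ x) {t : ℝ}
    (ht : δ ^ 2 * t ^ 2 ≤ 2) :
    Real.exp (-δ) * (1 - δ ^ 2 * t ^ 2 / 2) ^ 2 ≤ flatBase ψ t := by
  unfold flatBase
  have hre := h.re_weilMellin_half_line_ge t
  have hre0 : 0 ≤ 1 - δ ^ 2 * t ^ 2 / 2 := by linarith
  have hn : 1 - δ ^ 2 * t ^ 2 / 2 ≤ ‖weilMellin (mollC ψ) (1 / 2 + t * I)‖ :=
    hre.trans (Complex.re_le_norm _)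
  have hsq : (1 - δ ^ 2 * t ^ 2 / 2) ^ 2 ≤ ‖weilMellin (mollC ψ) (1 / 2 + t * I)‖ ^ 2 :=
    pow_le_pow_left₀ hre0 hn 2
  have hκ0 := h.expHalfMass_pos heven
  have hκ2 : expHalfMass ψ ^ 2 ≤ Real.exp δ :=
    calc expHalfMass ψ ^ 2 ≤ Real.exp (δ / 2) ^ 2 := pow_le_pow_left₀ hκ0.le h.expHalfMass_le 2
      _ = Real.exp δ := by rw [sq, ← Real.exp_add]; congr 1; ring
  have hinv : Real.exp (-δ) ≤ (expHalfMass ψ ^ 2)⁻¹ := by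
    rw [Real.exp_neg]; exact inv_anti₀ (pow_pos hκ0 2) hκ2
  calc Real.exp (-δ) * (1 - δ ^ 2 * t ^ 2 / 2) ^ 2
      ≤ (expHalfMass ψ ^ 2)⁻¹ * (1 - δ ^ 2 * t ^ 2 / 2) ^ 2 :=
        mul_le_mul_of_nonneg_right hinv (sq_nonneg _)
    _ ≤ (expHalfMass ψ ^ 2)⁻¹ * ‖weilMellin (mollC ψ) (1 / 2 + t * I)‖ ^ 2 :=
        mul_le_mul_of_nonneg_left hsq (by positivity)

/-- **Transparency of order `2m`.** For `δ²h² ≤ 2` and `|t| < |h|`: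
`1 - Φ(t) ≤ (1 - e^{-δ}(1 - δ²h²/2)²)^m`. -/
theorem one_sub_lineSymbol_flatKernel_le (h : IsMollifier ψ δ) (heven : ∀ x, ψ (-x) = ψ x)
    (m : ℕ) {hh t : ℝ} (hh2 : δ ^ 2 * hh ^ 2 ≤ 2) (ht : |t| < |hh|) :
    1 - (weilMellin (flatKernel ψ m) (1 / 2 + t * I)).re ≤
      (1 - Real.exp (-δ) * (1 - δ ^ 2 * hh ^ 2 / 2) ^ 2) ^ m := by
  rw [one_sub_lineSymbol_flatKernel h]
  have ht2 : t ^ 2 ≤ hh ^ 2 := (sq_lt_sq.2 ht).le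
  have htt : δ ^ 2 * t ^ 2 ≤ 2 := (mul_le_mul_of_nonneg_left ht2 (sq_nonneg _)).trans hh2
  have hb := flatBase_ge h heven htt
  have hmono : Real.exp (-δ) * (1 - δ ^ 2 * hh ^ 2 / 2) ^ 2 ≤
      Real.exp (-δ) * (1 - δ ^ 2 * t ^ 2 / 2) ^ 2 := by
    refine mul_le_mul_of_nonneg_left (pow_le_pow_left₀ (by linarith) ?_ 2) (Real.exp_pos _).le
    nlinarith
  refine pow_le_pow_left₀ (sub_nonneg.2 (flatBase_le_one h heven t)) ?_ m
  linarith

/-- **Even mollifier profiles exist** at every radius (symmetrise any profile). -/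
theorem exists_even_isMollifier (hδ : 0 < δ) :
    ∃ ψ : ℝ → ℝ, IsMollifier ψ δ ∧ ∀ x, ψ (-x) = ψ x := by
  obtain ⟨ψ₀, h₀⟩ := exists_isMollifier hδ
  refine ⟨fun x ↦ (ψ₀ x + ψ₀ (-x)) / 2, ⟨?_, fun x ↦ ?_, ?_, ?_⟩, fun x ↦ by simp [add_comm]⟩
  · exact ((h₀.contDiff.add (h₀.contDiff.comp contDiff_neg)).div_const 2)
  · have := h₀.nonneg x; have := h₀.nonneg (-x); positivity
  · have hneg : Integrable (fun x : ℝ ↦ ψ₀ (-x)) := h₀.integrable.comp_neg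
    rw [integral_div, integral_add h₀.integrable hneg, integral_neg_eq_self ψ₀ volume, h₀.mass]
    norm_num
  · refine tsupport_subset_of_eq_zero isClosed_Icc fun x hx ↦ ?_
    have hx' : δ < |x| := by by_contra hle; exact hx (abs_le.1 (not_lt.1 hle))
    have h1 := h₀.eq_zero_of_lt hx'
    have h2 := h₀.eq_zero_of_lt (show δ < |(-x)| by rwa [abs_neg])
    simp [h1, h2]

/-! ### Assembly into `HandoffSplitKernel` (appended 2026-08-24 by prove-1 gen10; also the APPEND
re-land of p375405, accepted 03:45Z but never built on the hub).  Nothing here bears on RH. -/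

/-- **The flat kernel of order `m` on an even profile of radius `δ` is a split kernel of radius
`2mδ`** (assembly of `flatKernel_split_fields`), so THEOREM V applies to it with `p = 0`. -/
theorem isSplitKernel_flatKernel (h : IsMollifier ψ δ) (heven : ∀ x, ψ (-x) = ψ x) (m : ℕ) :
    IsSplitKernel (flatKernel ψ m) (2 * m * δ) :=
  let ⟨h1, h2, h3, h4, h5, h6⟩ := flatKernel_split_fields h heven m; ⟨h1, h2, h3, h4, h5, h6⟩

end Summit.RiemannHypothesis.RiemannHypothesis.Theorems
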